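import Literature.AlgebraicGeometry.ComplexMultiplication.CMTypeRankTransport
import Literature.AlgebraicGeometry.ComplexMultiplication.EndomorphismFieldNondegenerateType
import Literature.NumberTheory.ComplexMultiplication.ShimuraTaniyamaHecke
import HarnessLib

/-!
# The HEREDITARY GOODNESS CRITERION: all abelian varieties with complex multiplication by a CM field `K` are stably
# nondegenerate iff every primitive CM type of every CM subfield of `K` is nondegenerate

COR-CM (cell `pub-hodgecm2`), binder seat b04 (gen 21), count-neutral — the conceptual capstone of the ALL-TYPES
programme (`A7-JUNCTION.md` gen 21: the principle behind parts III–XII).  KERNEL ONLY: theorems; no definition, no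
named fact, no `sorry`.  `HC_CM` is neither used nor claimed.

For ANY CM field `K` (no Galois hypothesis):

**`forall_isStablyNondegenerate_iff_hereditary`** — EVERY complex abelian variety `X` with `φ : K →+* End⁰(X)` and
`[K:ℚ] = 2 dim X` is stably nondegenerate (`B = D` on all powers; HC for everything isogenous to a power)
**iff** for every intermediate field `E ≤ K` every PRIMITIVE CM type of `E` is nondegenerate (fields `E` with a real
place carry no CM type, so only the CM subfields — `isCMField_of_cmType_intermediateField` — matter).

⟸ (`isStablyNondegenerate_of_hereditary`): lit-hodgefound's primitive core (`EndFieldFullDegree.exists_primitive_core`: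
`X ∼ B₁ʰ`, `B₁` the simple variety of record of the primitive core `(K₁; Φ₁)` of THE type, `K₁` an intermediate field
of an intermediate field `K'` of `K`), transported to the intermediate field `K₁.map K'.val ≤ K` along
`IntermediateField.equivMap` by gen 21's `CMTypeTransport` (rank, nondegeneracy and primitivity are invariant under
field isomorphisms).  ⟹ (`isNondegenerate_of_forall_isStablyNondegenerate`): a primitive degenerate `Ψ` on `E ≤ K`
lifts to `Ψ^K`, whose variety of record `A ∼ B^{[K:E]}` (`CMTorusRealisation.varietyOfIdeal_isIsogenous_powSucc`,
Shimura §6.2 Thm. 3) carries a `K`-action and is not stably nondegenerate (Hazama's criterion for the simple `B`,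
`isStablyNondegenerate_varietyOfIdeal_iff`; retract `IsStablyNondegenerate.of_powSucc`).

## References

* [Shimura1998] G. Shimura, *Abelian Varieties with Complex Multiplication and Modular Functions* (1998), §5.1 Prop. 3,
  §6.2 Thm. 3, §8.2 Prop. 26.
* [Gordon1999HodgeAVSurvey] B. B. Gordon, *A survey of the Hodge conjecture for abelian varieties*, Thm. 6.4, Def. 7.6,
  Rem. 7.6.1.
* [Kubota1965] T. Kubota, Trans. AMS 118 (1965), §2 (p. 115).

Provenance: Literature home (namespace `Literature.AlgebraicGeometry.ComplexMultiplication.HereditaryCriterion`) of the Summits-side `CorCM/CMFieldAllTypesHereditaryCriterion` (cell `pub-hodgecm2`, COR-CM; all its imports are `Literature/`, Mathlib and the already re-homed `CMTypeRankTransport`), which `Literature/` may not import; theorems only, no named fact, no definition. Nothing here bears on `HC_CM`. Lane `lit-hodgefound` (Layer A3: CM types, their Kubota ranks and Galois combinatorics), seat p20.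
-/

noncomputable section

open _root_.CategoryTheory _root_.CategoryTheory.Limits NumberField

namespace Literature.AlgebraicGeometry.ComplexMultiplication.HereditaryCriterion

open Literature.AlgebraicGeometry.ComplexMultiplication.CMTypeTransport

open Literature.NumberTheory.ComplexMultiplication
open Literature.AlgebraicGeometry Literature.AlgebraicGeometry.Motives Literature.AlgebraicGeometry.HodgeTheory
open Literature.AlgebraicGeometry.Motives.AbelianVariety
open Literature.AlgebraicGeometry.ComplexMultiplication
open Literature.AlgebraicGeometry.Pohlmann1968
open Literature.NumberTheory.Automorphic.PicardCM.CMCode (cmTypeMap mem_cmTypeMap_iff)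
open Literature.AlgebraicGeometry.ComplexMultiplication.CMTypeTransport

variable {K : Type} [Field K] [NumberField K]

/-! ## ⟸ Hereditary goodness implies all-types -/

/-- **Hereditary goodness ⟹ ALL-X.**  If every primitive CM type of every intermediate field of the number field `K` is
nondegenerate, then every complex abelian variety `X` with `φ : K →+* End⁰(X)`, `[K:ℚ] = 2 dim X`, is stably
nondegenerate. [cite: Shimura1998, §5.1 Prop. 3, §8.2 Prop. 26] [cite: Gordon1999HodgeAVSurvey, Thm. 6.4 and Def. 7.6] -/
theorem isStablyNondegenerate_of_hereditary
    (hgood : ∀ (E : IntermediateField ℚ K) (Ψ : CMType E) (ψ₀ : E →+* ℂ),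
      IsPrimitive (ℂ ≃+* ℂ) Ψ.1 ψ₀ → IsNondegenerate Ψ)
    {X : AbelianVariety ℂ} (φ : K →+* X.endAlgebra) (hX : Module.finrank ℚ K = 2 * X.dim) :
    IsStablyNondegenerate X := by
  obtain ⟨K', hK', K₁, hK₁, Φ₁, hprim, -, -, -, hS, -⟩ := EndFieldFullDegree.exists_primitive_core φ hX
  haveI := hK'
  haveI := hK₁
  apply hS
  -- transport the core to the intermediate field `K₁.map K'.val ≤ K`
  set E : IntermediateField ℚ K := K₁.map K'.val with hE_def
  let e : K₁ ≃+* E := (K₁.equivMap K'.val).toRingEquiv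
  set Ψ : CMType E := cmTypeMap e Φ₁ with hΨ_def
  have hprimΨ := (primitive_cmTypeMap_iff e Φ₁).2 hprim
  obtain ⟨ψ₀⟩ := (inferInstance : Nonempty (E →+* ℂ))
  have hΨ : IsNondegenerate Ψ := hgood E Ψ ψ₀ ((isPrimitive_ringEquiv_complex_iff Ψ ψ₀).2 hprimΨ)
  exact CMTorusRealisation.isStablyNondegenerate_varietyOfIdeal Φ₁ 1 ((isNondegenerate_cmTypeMap_iff e Φ₁).1 hΨ)

/-! ## ⟹ All-types implies hereditary goodness -/

/-- **ALL-X ⟹ hereditary goodness.**  `K` a CM field: if every complex abelian variety with a `K`-action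
(`[K:ℚ] = 2 dim X`) is stably nondegenerate, then every primitive CM type `Ψ` of every intermediate field `E ≤ K` is
nondegenerate — the variety of record of the lifted type `Ψ^K` is `∼ B^{[K:E]}` for the SIMPLE variety of record `B`
of `(E; Ψ)`, and `B` is a retract of `B^{[K:E]}`. [cite: Shimura1998, §6.2 Thm. 3, §8.2 Prop. 26]
[cite: Gordon1999HodgeAVSurvey, Thm. 6.4 and Rem. 7.6.1] -/
theorem isNondegenerate_of_forall_isStablyNondegenerate [IsCMField K]
    (h : ∀ (X : AbelianVariety ℂ) (_ : K →+* X.endAlgebra), Module.finrank ℚ K = 2 * X.dim → IsStablyNondegenerate X)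
    (E : IntermediateField ℚ K) (Ψ : CMType E) (ψ₀ : E →+* ℂ) (hprim : IsPrimitive (ℂ ≃+* ℂ) Ψ.1 ψ₀) :
    IsNondegenerate Ψ := by
  haveI : IsCMField E := isCMField_of_cmType_intermediateField E Ψ
  -- the variety of record of the lifted type, with its `K`-action
  set Φ : CMType K := inducedCMType (algebraMap E K) Ψ with hΦ_def
  obtain ⟨ι, θ, hA⟩ := CMTorusRealisation.exists_isCMTypeRealisation_varietyOfIdeal Φ
    (1 : (FractionalIdeal (nonZeroDivisors (𝓞 K)) K)ˣ)
  obtain ⟨i, -⟩ := exists_ringHom_endAlgebra ι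
  have hXst := h _ i (finrank_eq_two_mul_dim_of_isCMTypeRealisation hA)
  -- `A ∼ B^{[K:E]}`
  have h1 : Module.finrank E K = Module.finrank E K - 1 + 1 := (Nat.sub_add_cancel Module.finrank_pos).symm
  have hAB := CMTorusRealisation.varietyOfIdeal_isIsogenous_powSucc (Φ := Φ) (I := 1) rfl 1 h1
  have hB : IsStablyNondegenerate (CMTorusRealisation.varietyOfIdeal Ψ 1) := (hXst.of_isIsogenous' hAB).of_powSucc
  exact (CMTorusRealisation.isStablyNondegenerate_varietyOfIdeal_iff Ψ 1
    ((isPrimitive_ringEquiv_complex_iff Ψ ψ₀).1 hprim)).1 hB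

/-! ## The criterion -/

/-- **THE HEREDITARY GOODNESS CRITERION.**  For a CM field `K`: EVERY complex abelian variety `X` with
`φ : K →+* End⁰(X)` and `[K:ℚ] = 2 dim X` is STABLY NONDEGENERATE (`B = D` on all powers, the Hodge conjecture for
everything isogenous to a power) **iff** every PRIMITIVE CM type of every intermediate field `E ≤ K` is nondegenerate
— i.e. iff every SIMPLE CM abelian variety whose CM field embeds in `K` (with the induced degrees) is nondegenerate.
[cite: Shimura1998, §5.1 Prop. 3, §6.2 Thm. 3, §8.2 Prop. 26] [cite: Gordon1999HodgeAVSurvey, Thm. 6.4, Def. 7.6 and Rem. 7.6.1] -/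
theorem forall_isStablyNondegenerate_iff_hereditary [IsCMField K] :
    (∀ (X : AbelianVariety ℂ) (_ : K →+* X.endAlgebra), Module.finrank ℚ K = 2 * X.dim → IsStablyNondegenerate X) ↔
      ∀ (E : IntermediateField ℚ K) (Ψ : CMType E) (ψ₀ : E →+* ℂ),
        IsPrimitive (ℂ ≃+* ℂ) Ψ.1 ψ₀ → IsNondegenerate Ψ :=
  ⟨fun h E Ψ ψ₀ hprim => isNondegenerate_of_forall_isStablyNondegenerate h E Ψ ψ₀ hprim,
    fun hgood _ φ hX => isStablyNondegenerate_of_hereditary hgood φ hX⟩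

/-- **Realisation form of the criterion.** [cite: Shimura1998, §5.1–5.2] [cite: Gordon1999HodgeAVSurvey, Thm. 6.4] -/
theorem forall_realisation_isStablyNondegenerate_iff_hereditary [IsCMField K] :
    (∀ (Φ : CMType K) (A : AbelianVariety ℂ) (ι : 𝓞 K →+* End A) (θ : K →+* Module.End ℂ (complexBetti A.X 1)),
        IsCMTypeRealisation Φ A ι θ → IsStablyNondegenerate A) ↔
      ∀ (E : IntermediateField ℚ K) (Ψ : CMType E) (ψ₀ : E →+* ℂ),
        IsPrimitive (ℂ ≃+* ℂ) Ψ.1 ψ₀ → IsNondegenerate Ψ := by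
  rw [← forall_isStablyNondegenerate_iff_hereditary]
  constructor
  · intro h X i hX
    obtain ⟨X', φ', ι', hφι, f, hf⟩ := exists_principal_pair i
    have hdim' : Module.finrank ℚ K = 2 * X'.dim := by rw [← dim_eq_of_isIsogeny hf, hX]
    exact (h _ X' ι' _ (isCMTypeRealisation_cmTypeOfPair φ' hdim' ι' hφι)).of_isIsogenous ⟨f, hf⟩
  · intro h Φ A ι θ hA
    obtain ⟨i, -⟩ := exists_ringHom_endAlgebra ι
    exact h A i (finrank_eq_two_mul_dim_of_isCMTypeRealisation hA)

/-- **The Hodge conjecture from hereditary goodness**: for everything isogenous to a power of an abelian variety with an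
action of a hereditarily good number field. UNCONDITIONAL. [cite: Gordon1999HodgeAVSurvey, Thm. 6.3–6.4]
[cite: vanGeemen1994HodgeAV, Lemma 3.7] -/
theorem hodgeConjectureFor_of_isIsogenous_powSucc_of_hereditary
    (hgood : ∀ (E : IntermediateField ℚ K) (Ψ : CMType E) (ψ₀ : E →+* ℂ),
      IsPrimitive (ℂ ≃+* ℂ) Ψ.1 ψ₀ → IsNondegenerate Ψ)
    {X : AbelianVariety ℂ} (φ : K →+* X.endAlgebra) (hX : Module.finrank ℚ K = 2 * X.dim) {B : AbelianVariety ℂ}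
    {N : ℕ} (hB : IsIsogenous B (X.powSucc N)) : HodgeConjectureFor B.dim B.X :=
  (isStablyNondegenerate_of_hereditary hgood φ hX).hodgeConjectureFor_of_isIsogenous_powSucc hB

end Literature.AlgebraicGeometry.ComplexMultiplication.HereditaryCriterion

end
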